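import Mathlib
import Summits.Schanuel.Schanuel.Theorems.RootDecomp1EAnchorToolkit
import Summits.Schanuel.Schanuel.Theses.RootDecomp1E
import Summits.Schanuel.Schanuel.Theorems.RootDecomp1EEStableRung
import Literature.Barriers.Schanuel.LargeTranscendenceDegree
import Literature.NumberTheory.Transcendental.BakerLogarithmsConclusion

/-!
# RootDecomp1E — leaves of ROUND 7 «MultiplicationType» (lens 2, gen 7), part 1/4: span multipliers · (b) quartic E-line ⟸ Conj 2.3 (4,4) · (c) Baker ⟹ PLAIN · (d) transcendental-ratio grids PLAIN · (e) Brownawell–Waldschmidt cell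

MONOLITH = `g7/RootDecomp1EMultiplicationTypeLeaves.port.lean` (994 lines, lean check rc0 · 0 · 0 against the live tree 2026-08-30
≈09:10Z); this is PART 1/4 of its split at section boundaries for the 400-line cap (one namespace
`…Theorems.RootDecomp1EMultiplicationTypeLeaves` across the four modules; part k imports part k−1).  Parts 2–4 typecheck once
their predecessor is in the tree (the monolith is the checked reference).
Target `Summits/Schanuel/Schanuel/Theorems/RootDecomp1EMultiplicationTypeLeaves.lean`, `--supports stmt-Schanuel-31409` (EStableDefectOne; parts 3–4 equally
concern stmt-Schanuel-31410 PlainDefectOne).  See the monolith header for the per-theorem description.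
-/

set_option linter.dupNamespace false

noncomputable section

namespace Summit.Schanuel.Schanuel.Theorems.RootDecomp1EMultiplicationTypeLeaves

open Complex IntermediateField Module Polynomial
open Summit.Schanuel.Schanuel.Theorems.RootDecomp1EAnchor (isAlgebraic_of_mem_adjoin
  trdeg_adjoin_le_of_isAlgebraic mem_adjoin_of_mem_span exp_isAlgebraic_of_mem_span)
open Literature.Barriers.Schanuel (gridField₂ smallTrdeg_thm_2_9_pos smallTrdeg_thm_2_9_two_two
  WaldschmidtConjecture_2_3 trdeg_mono)
open Literature.NumberTheory.Transcendental (baker_holds)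
open Summit.Schanuel.Schanuel.Theorems.RootDecomp1EEStableRung (mul_mem_span_of_gens)


/-! ## Span multipliers -/

/-- Powers of a multiplier are multipliers. -/
theorem pow_mul_mem_span_of_gens {n : ℕ} {z : Fin n → ℂ} {β : ℂ}
    (h : ∀ i, β * z i ∈ Submodule.span ℚ (Set.range z)) (k : ℕ) {v : ℂ}
    (hv : v ∈ Submodule.span ℚ (Set.range z)) : β ^ k * v ∈ Submodule.span ℚ (Set.range z) := by
  induction k with
  | zero => simpa using hv
  | succ k ih =>
    have : β ^ (k + 1) * v = β * (β ^ k * v) := by ring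
    rw [this]
    exact mul_mem_span_of_gens h ih

/-! ## (b) The quartic E-line cell of `EStableDefectOne` is Conjecture 2.3 `(4,4)`, t₂-clause -/

/-- Dividing an independent family by a common factor keeps it independent. -/
theorem linearIndependent_of_mul_right {m : ℕ} {x : Fin m → ℂ} {lam : ℂ}
    (h : LinearIndependent ℚ (fun k => x k * lam)) : LinearIndependent ℚ x := by
  rw [Fintype.linearIndependent_iff] at h ⊢
  intro g hg k
  apply h g
  have : (∑ i, g i • (x i * lam)) = (∑ i, g i • x i) * lam := by
    rw [Finset.sum_mul]
    refine Finset.sum_congr rfl fun i _ => ?_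
    rw [smul_mul_assoc]
  rw [this, hg, zero_mul]

/-- **(b)** Under Waldschmidt's Conjecture 2.3 (tree: `WaldschmidtConjecture_2_3`, registered OPEN statement) the weak
piece `S⁻` holds on every QUARTIC E-LINE: if `z = (λ, βλ, β²λ, β³λ)` is ℚ-independent, `β` is algebraic and `β⁴λ ∈ span_ℚ z`
(so the span is `β`-stable, `β` is a quartic irrationality and `span_ℚ z = λ·ℚ(β)`), then `trdeg ℚ(z, e^z) ≥ 3 = n − 1`.
Instance: `d = ℓ = 4`, `x = (1, β, β², β³)`, `y = z`, t₂-clause `[dℓ/(ℓ+d)] + 1 = 3`; every grid generator is algebraic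
over `F_z = ℚ(z, e^z)` because `β^k λ ∈ span_ℚ z` for all `k`.  (Unconditionally the tree's Theorem 2.9 t₂ gives only
`[16/8] = 2` here, and only under the technical hypothesis: barrier B3 `LargeTranscendenceDegree`.) -/
theorem three_le_trdeg_quarticLine_of_conj23 (h23 : WaldschmidtConjecture_2_3) (lam β : ℂ)
    (hβ : IsAlgebraic ℚ β)
    (hli : LinearIndependent ℚ ![lam, β * lam, β ^ 2 * lam, β ^ 3 * lam])
    (h4 : β ^ 4 * lam ∈ Submodule.span ℚ (Set.range ![lam, β * lam, β ^ 2 * lam, β ^ 3 * lam])) :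
    (3 : Cardinal) ≤ Algebra.trdeg ℚ ↥(adjoin ℚ (Set.range ![lam, β * lam, β ^ 2 * lam, β ^ 3 * lam] ∪
      Set.range (cexp ∘ ![lam, β * lam, β ^ 2 * lam, β ^ 3 * lam]))) := by
  set z : Fin 4 → ℂ := ![lam, β * lam, β ^ 2 * lam, β ^ 3 * lam] with hz
  set x : Fin 4 → ℂ := ![(1 : ℂ), β, β ^ 2, β ^ 3] with hx
  have hzx : (fun k => x k * lam) = z := by
    funext k
    fin_cases k <;> simp [hx, hz]
  have hxli : LinearIndependent ℚ x := linearIndependent_of_mul_right (hzx ▸ hli)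
  have hzV : ∀ j, z j ∈ Submodule.span ℚ (Set.range z) := fun j => Submodule.subset_span ⟨j, rfl⟩
  have hst : ∀ i, β * z i ∈ Submodule.span ℚ (Set.range z) := by
    intro i
    fin_cases i
    · simpa [hz] using hzV 1
    · have e : β * (β * lam) = β ^ 2 * lam := by ring
      simpa [hz, e] using hzV 2
    · have e : β * (β ^ 2 * lam) = β ^ 3 * lam := by ring
      simpa [hz, e] using hzV 3
    · have e : β * (β ^ 3 * lam) = β ^ 4 * lam := by ring
      simpa [hz, e] using h4
  have h3 := (h23 4 4 x z hxli hli (by norm_num) (by norm_num)).2.2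
  have h44 : ((4 * 4 / (4 + 4) + 1 : ℕ) : Cardinal) = 3 := by norm_num
  rw [h44] at h3
  refine h3.trans ?_
  set F : IntermediateField ℚ ℂ := adjoin ℚ (Set.range z ∪ Set.range (cexp ∘ z)) with hF
  have hxV : ∀ i, ∀ v ∈ Submodule.span ℚ (Set.range z), x i * v ∈ Submodule.span ℚ (Set.range z) := by
    intro i v hv
    fin_cases i
    · simpa [hx] using hv
    · simpa [hx] using mul_mem_span_of_gens hst hv
    · simpa [hx] using pow_mul_mem_span_of_gens hst 2 hv
    · simpa [hx] using pow_mul_mem_span_of_gens hst 3 hv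
  show Algebra.trdeg ℚ ↥(adjoin ℚ (Set.range x ∪ Set.range z ∪
      Set.range (fun p : Fin 4 × Fin 4 => cexp (x p.1 * z p.2)))) ≤ Algebra.trdeg ℚ ↥F
  apply trdeg_adjoin_le_of_isAlgebraic
  rintro t ((⟨i, rfl⟩ | ⟨j, rfl⟩) | ⟨p, rfl⟩)
  · fin_cases i
    · simpa [hx] using (isAlgebraic_one : IsAlgebraic ℚ (1 : ℂ)).tower_top (L := ↥F)
    · simpa [hx] using hβ.tower_top (L := ↥F)
    · simpa [hx] using (hβ.pow 2).tower_top (L := ↥F)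
    · simpa [hx] using (hβ.pow 3).tower_top (L := ↥F)
  · exact isAlgebraic_of_mem_adjoin (mem_adjoin_of_mem_span (hzV j))
  · exact exp_isAlgebraic_of_mem_span (hxV p.1 _ (hzV p.2))

/-- **(b′)** `S⁻`-shaped corollary: Conjecture 2.3 gives `EStableDefectOne`'s conclusion `4 ≤ trdeg + 1` on quartic E-lines. -/
theorem defectOne_quarticLine_of_conj23 (h23 : WaldschmidtConjecture_2_3) (lam β : ℂ)
    (hβ : IsAlgebraic ℚ β)
    (hli : LinearIndependent ℚ ![lam, β * lam, β ^ 2 * lam, β ^ 3 * lam])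
    (h4 : β ^ 4 * lam ∈ Submodule.span ℚ (Set.range ![lam, β * lam, β ^ 2 * lam, β ^ 3 * lam])) :
    ((4 : ℕ) : Cardinal) ≤ Algebra.trdeg ℚ ↥(adjoin ℚ (Set.range ![lam, β * lam, β ^ 2 * lam, β ^ 3 * lam] ∪
      Set.range (cexp ∘ ![lam, β * lam, β ^ 2 * lam, β ^ 3 * lam]))) + 1 := by
  have h := three_le_trdeg_quarticLine_of_conj23 h23 lam β hβ hli h4
  have h' := add_le_add h (le_rfl : (1 : Cardinal) ≤ 1)
  have h31 : (3 : Cardinal) + 1 = ((4 : ℕ) : Cardinal) := by norm_num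
  rw [h31] at h'
  exact h'

/-! ## (c) Baker ⟹ tuples with algebraic exponentials admit only rational algebraic multipliers (PLAIN) -/

/-- **(c)** UNCONDITIONAL.  If `z` (length `n ≥ 1`) is ℚ-independent and every `e^{z_i}` is algebraic, then `span_ℚ z` is
PLAIN: an algebraic `β` with `β z_i ∈ span_ℚ z` is rational.  Proof: Baker (tree THEOREM `baker_holds`) makes
`z_0, …, z_{n-1}` linearly independent over `ℚ̄ = algebraicClosure ℚ ℂ`; the relation `β z_0 − Σ c_j z_j = 0` has
coefficients in `ℚ̄`, hence `β = c_0 ∈ ℚ`.  So `(log 2, log 3, log 5)`, `(iπ, log 2, log 3)`, … lie in `PlainDefectOne`. -/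
theorem rational_multiplier_of_exp_isAlgebraic (n : ℕ) (hn : 0 < n) (z : Fin n → ℂ)
    (hz : LinearIndependent ℚ z) (halg : ∀ i, IsAlgebraic ℚ (cexp (z i)))
    (β : ℂ) (hβ : IsAlgebraic ℚ β) (hβV : ∀ i, β * z i ∈ Submodule.span ℚ (Set.range z)) :
    β ∈ Set.range (algebraMap ℚ ℂ) := by
  classical
  set i₀ : Fin n := ⟨0, hn⟩ with hi₀
  obtain ⟨c, hc⟩ := (Submodule.mem_span_range_iff_exists_fun ℚ).mp (hβV i₀)
  have hB := baker_holds z halg hz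
  set K : IntermediateField ℚ ℂ := algebraicClosure ℚ ℂ with hK
  have hβK : β ∈ K := (mem_algebraicClosure_iff).mpr hβ
  have hz' : LinearIndependent (↥K) z :=
    hB.comp (some : Fin n → Option (Fin n)) (Option.some_injective _)
  rw [Fintype.linearIndependent_iff] at hz'
  let g : Fin n → ↥K := fun j => algebraMap ℚ (↥K) (c j) - if j = i₀ then ⟨β, hβK⟩ else 0
  have hcoe : ∀ j, ((g j : ↥K) : ℂ) = (c j : ℂ) - if j = i₀ then β else 0 := by
    intro j
    simp only [g]
    split_ifs <;> simp
  have hsum : ∑ j, g j • z j = 0 := by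
    have h1 : ∀ j, g j • z j = ((c j : ℂ) - if j = i₀ then β else 0) * z j := by
      intro j
      rw [← hcoe j]
      rfl
    simp_rw [h1, sub_mul, Finset.sum_sub_distrib]
    have h2 : ∑ j, (c j : ℂ) * z j = β * z i₀ := by
      rw [← hc]
      refine Finset.sum_congr rfl fun j _ => ?_
      rw [Algebra.smul_def]
      rfl
    rw [h2]
    simp [ite_mul, Finset.sum_ite_eq']
  have hg0 := hz' g hsum i₀
  have hval := congrArg (fun k : ↥K => (k : ℂ)) hg0
  simp only [hcoe] at hval
  refine ⟨c i₀, ?_⟩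
  have : (c i₀ : ℂ) - β = 0 := by simpa using hval
  rw [sub_eq_zero] at this
  simpa [Algebra.algebraMap_eq_smul_one] using this

/-! ## (d) Rank-one grids with transcendental ratio are PLAIN -/

/-- **(d)** If `β` is transcendental and `(u, uβ, uβ²)` is ℚ-independent, then `span_ℚ(u, uβ, uβ²)` is PLAIN: an algebraic
multiplier `γ` satisfies `γ = c₀ + c₁β + c₂β²` with `cᵢ ∈ ℚ`, and `(c₁, c₂) ≠ 0` would make `β` algebraic (a root of
`P ∘ (c₀ + c₁X + c₂X²)` for the minimal-type polynomial `P` of `γ`).  With (c) of g2 (`rankOneGridThree_logRatio`: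
`e^u, e^{uβ} ∈ ℚ̄`, `β ∉ ℚ`, hence `β` transcendental by Gel'fond–Schneider) this places that DECIDED family inside
`PlainDefectOne`'s first open length `n = 3`. -/
theorem rational_multiplier_of_rankOneGrid_transcendental (u β : ℂ) (hβ : Transcendental ℚ β)
    (hli : LinearIndependent ℚ ![u, u * β, u * β ^ 2]) (γ : ℂ) (hγ : IsAlgebraic ℚ γ)
    (hγV : ∀ i, γ * ![u, u * β, u * β ^ 2] i ∈ Submodule.span ℚ (Set.range ![u, u * β, u * β ^ 2])) :
    γ ∈ Set.range (algebraMap ℚ ℂ) := by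
  classical
  have hu : u ≠ 0 := by
    intro h0
    exact hli.ne_zero 0 (by simp [h0])
  obtain ⟨c, hc⟩ := (Submodule.mem_span_range_iff_exists_fun ℚ).mp (hγV 0)
  have hc' : ((c 0 : ℂ) + (c 1 : ℂ) * β + (c 2 : ℂ) * β ^ 2) * u = γ * u := by
    have e : γ * ![u, u * β, u * β ^ 2] 0 = γ * u := by simp
    rw [← e, ← hc]
    simp [Fin.sum_univ_three, Algebra.smul_def]
    ring
  have hγeq : γ = (c 0 : ℂ) + (c 1 : ℂ) * β + (c 2 : ℂ) * β ^ 2 :=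
    (mul_right_cancel₀ hu hc').symm
  by_cases h12 : c 1 = 0 ∧ c 2 = 0
  · refine ⟨c 0, ?_⟩
    rw [hγeq, h12.1, h12.2]
    simp
  · exfalso
    apply hβ
    obtain ⟨P, hP0, hPγ⟩ := hγ
    set q : ℚ[X] := C (c 0) + C (c 1) * X + C (c 2) * X ^ 2 with hq
    have hqβ : aeval β q = γ := by
      rw [hγeq, hq]
      simp
    have hqdeg : 0 < q.natDegree := by
      by_contra hcon
      have h0 : q.natDegree = 0 := by omega
      have h1 : q.coeff 1 = 0 := coeff_eq_zero_of_natDegree_lt (by omega)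
      have h2 : q.coeff 2 = 0 := coeff_eq_zero_of_natDegree_lt (by omega)
      rw [hq] at h1 h2
      simp [coeff_X_pow, coeff_C] at h1 h2
      exact h12 ⟨h1, h2⟩
    have hPdeg : 0 < P.natDegree :=
      natDegree_pos_of_aeval_root hP0 hPγ (fun x hx => by simpa using hx)
    refine ⟨P.comp q, ?_, by rw [aeval_comp, hqβ, hPγ]⟩
    intro h0
    have hd := congrArg natDegree h0
    rw [natDegree_comp, natDegree_zero] at hd
    exact (Nat.mul_pos hPdeg hqdeg).ne' hd


/-! ## (e) The Brownawell–Waldschmidt cell inside `PlainDefectOne`'s first open length -/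

/-- **(e) The Brownawell–Waldschmidt cell.** Mod the tree THEOREM `smallTrdeg_thm_2_9_two_two`
(discharged by `smallTrdeg_thm_2_9_two_two_holds`, `LargeTranscendenceDegreeTwoTwoProofs.lean`; hypothesis form only because that
module's cone was unbuilt on the farm, rc 75 at 09:02Z).  If the
ℚ-span of `z` contains a `(2,2)` grid `{y₁, y₂, x y₁, x y₂}` with `(1, x)` and `(y₁, y₂)` ℚ-independent and `e^{y₁}`, `e^{y₂}`
algebraic, then `trdeg ℚ(z, e^z) ≥ 2`.  For a TRIPLE this is `S⁻` (`3 ≤ 2 + 1`): it generalises g2's decided family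
`rankOneGridThree_logRatio` (`y = (u, uβ)`, `x = β`) to Möbius-ratio triples such as `(log 2, log 3, β log 2)` with
`β = (a log 2 + b log 3)/(log 3 − c log 2)` — certified members of `PlainDefectOne`'s first open length on which `S⁻` HOLDS. -/
theorem two_le_trdeg_of_bwGrid (hBW : smallTrdeg_thm_2_9_two_two) {n : ℕ} (z : Fin n → ℂ) (x y₁ y₂ : ℂ)
    (hx : LinearIndependent ℚ ![(1 : ℂ), x]) (hy : LinearIndependent ℚ ![y₁, y₂])
    (h₁ : y₁ ∈ Submodule.span ℚ (Set.range z)) (h₂ : y₂ ∈ Submodule.span ℚ (Set.range z))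
    (h₃ : x * y₁ ∈ Submodule.span ℚ (Set.range z)) (h₄ : x * y₂ ∈ Submodule.span ℚ (Set.range z))
    (ha₁ : IsAlgebraic ℚ (cexp y₁)) (ha₂ : IsAlgebraic ℚ (cexp y₂)) :
    (2 : Cardinal) ≤ Algebra.trdeg ℚ ↥(adjoin ℚ (Set.range z ∪ Set.range (cexp ∘ z))) := by
  set xv : Fin 2 → ℂ := ![(1 : ℂ), x] with hxv
  set yv : Fin 2 → ℂ := ![y₁, y₂] with hyv
  have hBW2 := hBW xv yv hx hy (by simpa [hxv, hyv] using ha₁) (by simpa [hxv, hyv] using ha₂)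
  refine hBW2.trans ?_
  set F : IntermediateField ℚ ℂ := adjoin ℚ (Set.range z ∪ Set.range (cexp ∘ z)) with hF
  have hy₁0 : y₁ ≠ 0 := by simpa [hyv] using hy.ne_zero 0
  -- `x = (x y₁) / y₁ ∈ F`
  have hxF : x ∈ F := by
    have hq : x = (x * y₁) * y₁⁻¹ := by field_simp
    rw [hq]
    exact mul_mem (mem_adjoin_of_mem_span h₃) (inv_mem (mem_adjoin_of_mem_span h₁))
  have hxyV : ∀ p : Fin 2 × Fin 2, xv p.1 * yv p.2 ∈ Submodule.span ℚ (Set.range z) := by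
    rintro ⟨i, j⟩
    fin_cases i <;> fin_cases j
    · simpa [hxv, hyv] using h₁
    · simpa [hxv, hyv] using h₂
    · simpa [hxv, hyv] using h₃
    · simpa [hxv, hyv] using h₄
  show Algebra.trdeg ℚ ↥(adjoin ℚ (Set.range xv ∪ Set.range yv ∪
      Set.range (fun p : Fin 2 × Fin 2 => cexp (xv p.1 * yv p.2)))) ≤ Algebra.trdeg ℚ ↥F
  apply trdeg_adjoin_le_of_isAlgebraic
  rintro t ((⟨i, rfl⟩ | ⟨j, rfl⟩) | ⟨p, rfl⟩)
  · fin_cases i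
    · simpa [hxv] using (isAlgebraic_one : IsAlgebraic ℚ (1 : ℂ)).tower_top (L := ↥F)
    · simpa [hxv] using isAlgebraic_of_mem_adjoin hxF
  · fin_cases j
    · simpa [hyv] using isAlgebraic_of_mem_adjoin (mem_adjoin_of_mem_span h₁)
    · simpa [hyv] using isAlgebraic_of_mem_adjoin (mem_adjoin_of_mem_span h₂)
  · exact exp_isAlgebraic_of_mem_span (hxyV p)

/-- **(e′)** `S⁻`-reading at length 3. -/
theorem defectOne_three_of_bwGrid (hBW : smallTrdeg_thm_2_9_two_two) (z : Fin 3 → ℂ) (x y₁ y₂ : ℂ)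
    (hx : LinearIndependent ℚ ![(1 : ℂ), x]) (hy : LinearIndependent ℚ ![y₁, y₂])
    (h₁ : y₁ ∈ Submodule.span ℚ (Set.range z)) (h₂ : y₂ ∈ Submodule.span ℚ (Set.range z))
    (h₃ : x * y₁ ∈ Submodule.span ℚ (Set.range z)) (h₄ : x * y₂ ∈ Submodule.span ℚ (Set.range z))
    (ha₁ : IsAlgebraic ℚ (cexp y₁)) (ha₂ : IsAlgebraic ℚ (cexp y₂)) :
    ((3 : ℕ) : Cardinal) ≤ Algebra.trdeg ℚ ↥(adjoin ℚ (Set.range z ∪ Set.range (cexp ∘ z))) + 1 := by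
  have h := add_le_add (two_le_trdeg_of_bwGrid hBW z x y₁ y₂ hx hy h₁ h₂ h₃ h₄ ha₁ ha₂)
    (le_rfl : (1 : Cardinal) ≤ 1)
  have h21 : (2 : Cardinal) + 1 = ((3 : ℕ) : Cardinal) := by norm_num
  rw [h21] at h
  exact h


/-! ## (i) The item reduced to lengths `n ≥ 4` (the decided rung `n ≤ 3` is in the tree: `Theorems.RootDecomp1EEStableRung`) -/

/-- **REDUCTION OF THE ITEM TO LENGTHS `≥ 4`** (references the tree decl `RootDecomp1E.EStableDefectOne`,
stmt-Schanuel-31409, rendered by the round-7 edit of 2026-08-30 08:53Z): mod the tree theorem `smallTrdeg_thm_2_9_pos`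
(`smallTrdeg_thm_2_9_pos_holds`) and via the LANDED rung `Theorems.RootDecomp1EEStableRung.eStableDefectOne_le_three`, the crux `EStableDefectOne` is EQUIVALENT to its restriction to lengths `n ≥ 4` — the
lengths `n ≤ 3` are the decided rung `eStableDefectOne_le_three`.  First open cells: the Gaussian plane `(1, i, π, iπ)` and the
quartic number-field lines `λ(1, β, β², β³)` (the latter reachable from Waldschmidt's Conjecture 2.3, lens-2 g7 addendum (b)). -/
theorem eStableDefectOne_iff_four_le (h29 : smallTrdeg_thm_2_9_pos) :
    Summit.Schanuel.Schanuel.Theses.RootDecomp1E.EStableDefectOne ↔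
      ∀ (n : ℕ), 4 ≤ n → ∀ (z : Fin n → ℂ), LinearIndependent ℚ z →
        (∃ β : ℂ, IsAlgebraic ℚ β ∧ β ∉ Set.range (algebraMap ℚ ℂ) ∧
          ∀ i, β * z i ∈ Submodule.span ℚ (Set.range z)) →
        (∀ (m : ℕ) (w : Fin m → ℂ), m < n → LinearIndependent ℚ w →
          (∀ j, w j ∈ Submodule.span ℚ (Set.range z)) →
          (m : Cardinal) ≤ Algebra.trdeg ℚ ↥(IntermediateField.adjoin ℚ
            (Set.range w ∪ Set.range (Complex.exp ∘ w))) + 1) →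
        (n : Cardinal) ≤ Algebra.trdeg ℚ ↥(IntermediateField.adjoin ℚ
          (Set.range z ∪ Set.range (Complex.exp ∘ z))) + 1 := by
  constructor
  · intro h n _ z hz hE hsub
    exact h n z hz hE hsub
  · intro h n z hz hE hsub
    rcases Nat.lt_or_ge n 4 with hn | hn
    · exact Summit.Schanuel.Schanuel.Theorems.RootDecomp1EEStableRung.eStableDefectOne_le_three h29 n (by omega)
        z hz hE hsub
    · exact h n hn z hz hE hsub

end Summit.Schanuel.Schanuel.Theorems.RootDecomp1EMultiplicationTypeLeaves

end
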